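import Literature.AlgebraicTopology.Homotopy.StellarSigns
import Literature.AlgebraicTopology.Homotopy.GlueProduct
import HarnessLib

/-!
# The stellar homotopy addition theorem

Topic `Literature/AlgebraicTopology/Homotopy`. For a based simplicial sphere `G : Δᵏ → X` which
is *stellar* with faces `g₀, …, g_k` (`IsStellar G g`: on each region `{νⱼ minimal}`, `G` is
`gⱼ` read through the stellar map `stellarPt j`), **the class of `G` is the alternating product of
the classes of the faces**:

* `CSphere.toClass_hat_eq_prod_stellarPiece`: `toClass (hat G) = ∏ⱼ toClass (stellarPiece G … j)` —
  shrink the pieces about the stellar centres (`CSphere.shrinkAt` of `GlueSpheres.lean`, a homotopy), whose heights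
  (coordinate `0`) are distinct, and cut along walls between them (`CSphere.toClass_glue_eq_prod` of
  `GlueProduct.lean`); this part is
  sign-free;
* `CSphere.toClass_hat_stellar` (**stellar HAT**):
  `toClass (hat G) = ∏ⱼ toClass (hat gⱼ) ^ (-1)^j`, by `CSphere.toClass_stellarPiece`
  (`StellarSigns.lean`).

This is the form of the homotopy addition theorem (Hatcher, *Algebraic Topology* (2002), §4.1,
the sum in `πₙ`; Lemma 4.36-type additivity; Bredon, *Topology and Geometry* (1993), VII
Thm. 9.5) used by the tree's elementary proof of the Hurewicz vanishing theorem: it is applied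
to the parallel projection of a singular `(k+1)`-simplex onto the union of its faces `≠ 0`.
Everything is proved, by the cutting and pasting of compactly supported spheres; `[folklore]`.

## References

* A. Hatcher, *Algebraic Topology*, CUP (2002), §4.1, p. 340. [HatcherAT2002]
* G. E. Bredon, *Topology and Geometry*, GTM 139 (1993), Ch. VII, Thm. 9.5 (homotopy addition).
  [Bredon1993]
-/

noncomputable section

open Set Metric Topology Equiv
open scoped Topology.Homotopy

universe u

namespace Literature.AlgebraicTopology.Homotopy

variable {k : ℕ} {X : Type u} [TopologicalSpace X] {x₀ : X}

/-! ### Heights of the stellar centres -/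

/-- The height (coordinate `0`) of the stellar centre `j`: `(1 + εⱼ)/(k+1) - [j = 1] εⱼ`.
[folklore] -/
theorem stellarCenter_zero [NeZero k] (j : Fin (k + 1)) :
    stellarCenter j (0 : Fin k) =
      (1 + stellarEps k j) / ((k : ℝ) + 1) - if j = 1 then stellarEps k j else 0 := by
  have h1 : (Fin.succ (0 : Fin k) : Fin (k + 1)) = 1 := Fin.succ_zero_eq_one'
  simp only [stellarCenter, h1]
  by_cases hj : j = 1
  · subst hj; simp
  · rw [if_neg hj, if_neg (fun h => hj h.symm)]

/-- The height order: `swap 0 1` lists the centres from bottom to top (`1, 0, 2, 3, …`).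
[folklore] -/
def heightOrder (k : ℕ) : Perm (Fin (k + 1)) := Equiv.swap 0 1

/-- The value of a `Fin (k+1)` numeral `1` is `1` for `k ≥ 1`. [folklore] -/
theorem fin_val_one [NeZero k] : ((1 : Fin (k + 1)) : ℕ) = 1 := by
  rw [Fin.val_one', Nat.one_mod_eq_one]
  have := NeZero.one_le (n := k); omega

/-- The height order on values: `0 ↦ 1`, `1 ↦ 0`, `j ↦ j` otherwise. [folklore] -/
theorem heightOrder_val [NeZero k] (j : Fin (k + 1)) :
    ((heightOrder k j : Fin (k + 1)) : ℕ) = if (j : ℕ) = 0 then 1 else if (j : ℕ) = 1 then 0 else (j : ℕ) := by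
  unfold heightOrder
  rcases eq_or_ne j 0 with rfl | hj0
  · rw [swap_apply_left, fin_val_one, Fin.val_zero]; simp
  · rcases eq_or_ne j 1 with rfl | hj1
    · rw [swap_apply_right, Fin.val_zero, fin_val_one]; simp
    · rw [swap_apply_of_ne_of_ne hj0 hj1]
      have h0 : (j : ℕ) ≠ 0 := fun h => hj0 (Fin.ext (by rw [h]; rfl))
      have h1 : (j : ℕ) ≠ 1 := fun h => hj1 (Fin.ext (by rw [h, fin_val_one]))
      simp [h0, h1]

/-- The sorted heights. [folklore] -/
def sortedHeight (k : ℕ) [NeZero k] (i : Fin (k + 1)) : ℝ := stellarCenter (heightOrder k i) (0 : Fin k)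

/-- The unit `c = 1/(4 (k+1)²)` of the parameters `εⱼ = (j + 1) c`. [folklore] -/
def epsUnit (k : ℕ) : ℝ := (4 * ((k : ℝ) + 1) ^ 2)⁻¹

/-- `εⱼ = (j + 1) c`. [folklore] -/
theorem stellarEps_eq (j : Fin (k + 1)) : stellarEps k j = ((j : ℝ) + 1) * epsUnit k := by
  unfold stellarEps epsUnit; rw [div_eq_mul_inv]

/-- **The sorted heights, explicitly**: `Hᵢ = (1 + (vᵢ + 1) c)/(k+1) - [i = 0] 2c` with
`vᵢ` the value of `heightOrder i`. [folklore] -/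
theorem sortedHeight_eq [NeZero k] (i : Fin (k + 1)) :
    sortedHeight k i = (1 + (((heightOrder k i : Fin (k + 1)) : ℕ) + 1) * epsUnit k) / ((k : ℝ) + 1) -
      if (i : ℕ) = 0 then 2 * epsUnit k else 0 := by
  rw [sortedHeight, stellarCenter_zero, stellarEps_eq]
  congr 1
  have hiff : heightOrder k i = 1 ↔ (i : ℕ) = 0 := by
    unfold heightOrder
    rw [Equiv.swap_apply_eq_iff, swap_apply_right]
    exact ⟨fun h => by rw [h]; rfl, fun h => Fin.ext h⟩
  by_cases hi : (i : ℕ) = 0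
  · rw [if_pos (hiff.2 hi), if_pos hi, hiff.2 hi, fin_val_one]; norm_num
  · rw [if_neg (fun h => hi (hiff.1 h)), if_neg hi]

/-- The minimal gap between sorted heights: `γ = c/(k+1) = 1/(4 (k+1)³)`. [folklore] -/
def heightGap (k : ℕ) : ℝ := epsUnit k / ((k : ℝ) + 1)

/-- `0 < γ`. [folklore] -/
theorem heightGap_pos (k : ℕ) : 0 < heightGap k := by unfold heightGap epsUnit; positivity

/-- The bottom height (centre `1`). [folklore] -/
theorem sortedHeight_val_zero [NeZero k] (i : Fin (k + 1)) (hi : (i : ℕ) = 0) :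
    sortedHeight k i = (1 + 2 * epsUnit k) / ((k : ℝ) + 1) - 2 * epsUnit k := by
  rw [sortedHeight_eq, heightOrder_val, if_pos hi, if_pos hi]; norm_num

/-- The second height (centre `0`). [folklore] -/
theorem sortedHeight_val_one [NeZero k] (i : Fin (k + 1)) (hi : (i : ℕ) = 1) :
    sortedHeight k i = (1 + epsUnit k) / ((k : ℝ) + 1) := by
  rw [sortedHeight_eq, heightOrder_val, if_neg (by omega), if_pos hi, if_neg (by omega)]; norm_num

/-- The higher heights (centres `j ≥ 2`). [folklore] -/
theorem sortedHeight_val_two_le [NeZero k] (i : Fin (k + 1)) (hi : 2 ≤ (i : ℕ)) :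
    sortedHeight k i = (1 + ((i : ℕ) + 1 : ℝ) * epsUnit k) / ((k : ℝ) + 1) := by
  rw [sortedHeight_eq, heightOrder_val, if_neg (by omega), if_neg (by omega), if_neg (by omega), sub_zero]

/-- **Consecutive sorted heights differ by at least `γ`** (`k ≥ 1`). [folklore] -/
theorem heightGap_le_sub [NeZero k] (i : Fin k) :
    heightGap k ≤ sortedHeight k i.succ - sortedHeight k i.castSucc := by
  have hk : (1 : ℝ) ≤ k := by exact_mod_cast NeZero.one_le
  have hk1 : (0 : ℝ) < (k : ℝ) + 1 := by positivity
  have hc : 0 < epsUnit k := by unfold epsUnit; positivity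
  have hs : ((i.succ : Fin (k + 1)) : ℕ) = (i : ℕ) + 1 := Fin.val_succ i
  have hcv : ((i.castSucc : Fin (k + 1)) : ℕ) = (i : ℕ) := Fin.val_castSucc i
  unfold heightGap
  rcases Nat.lt_or_ge (i : ℕ) 2 with hlt | hge
  · rcases (show (i : ℕ) = 0 ∨ (i : ℕ) = 1 by omega) with h | h
    · -- the centres `1` (bottom) and `0`
      rw [sortedHeight_val_one i.succ (by rw [hs, h]), sortedHeight_val_zero i.castSucc (by rw [hcv, h]),
        ← sub_nonneg]
      have : (1 + epsUnit k) / ((k : ℝ) + 1) - ((1 + 2 * epsUnit k) / ((k : ℝ) + 1) - 2 * epsUnit k) -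
          epsUnit k / ((k : ℝ) + 1) = 2 * k * epsUnit k / ((k : ℝ) + 1) := by
        field_simp; ring
      rw [this]; positivity
    · -- the centres `0` and `2`
      rw [sortedHeight_val_two_le i.succ (by rw [hs, h]), sortedHeight_val_one i.castSucc (by rw [hcv, h]),
        hs, h, ← sub_nonneg]
      push_cast
      have : (1 + ((2 : ℝ) + 1) * epsUnit k) / ((k : ℝ) + 1) - (1 + epsUnit k) / ((k : ℝ) + 1) -
          epsUnit k / ((k : ℝ) + 1) = epsUnit k / ((k : ℝ) + 1) := by
        field_simp; ring
      rw [this]; positivity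
  · -- the centres `a` and `a + 1`, `a ≥ 2`
    rw [sortedHeight_val_two_le i.succ (by rw [hs]; omega),
      sortedHeight_val_two_le i.castSucc (by rw [hcv]; exact hge), hs, hcv, ← sub_nonneg]
    push_cast
    have : (1 + ((i : ℝ) + 1 + 1) * epsUnit k) / ((k : ℝ) + 1) - (1 + ((i : ℝ) + 1) * epsUnit k) / ((k : ℝ) + 1) -
        epsUnit k / ((k : ℝ) + 1) = 0 := by
      field_simp; ring
    rw [this]

/-- Sorted heights are increasing. [folklore] -/
theorem sortedHeight_mono [NeZero k] : Monotone (sortedHeight k) := by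
  refine Fin.monotone_iff_le_succ.2 fun i => ?_
  linarith [heightGap_le_sub i, heightGap_pos k]

/-- The walls: `Hᵢ - γ/2` for `i ≤ k`, and `H_k + γ/2` on top. [folklore] -/
def stellarWall (k : ℕ) [NeZero k] : Fin (k + 2) → ℝ :=
  Fin.snoc (fun i : Fin (k + 1) => sortedHeight k i - heightGap k / 2) (sortedHeight k (Fin.last k) + heightGap k / 2)

/-- The walls are monotone. [folklore] -/
theorem stellarWall_mono [NeZero k] : Monotone (stellarWall k) := by
  refine Fin.monotone_iff_le_succ.2 fun i => ?_
  simp only [stellarWall]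
  rcases eq_or_ne i (Fin.last k) with rfl | hi
  · rw [show (Fin.last k).castSucc = (Fin.last k).castSucc from rfl, Fin.snoc_castSucc,
      show (Fin.last k).succ = Fin.last (k + 1) from Fin.succ_last k, Fin.snoc_last]
    linarith [heightGap_pos k]
  · obtain ⟨i', rfl⟩ : ∃ i' : Fin k, i = i'.castSucc := by
      refine ⟨i.castPred hi, (Fin.castSucc_castPred i hi).symm⟩
    rw [Fin.snoc_castSucc, show i'.castSucc.succ = i'.succ.castSucc from rfl, Fin.snoc_castSucc]
    linarith [heightGap_le_sub i', heightGap_pos k]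

namespace CSphere

variable {G : C(stdSimplex ℝ (Fin (k + 1)), X)} {g : Fin (k + 1) → C(stdSimplex ℝ (Fin (k + 1)), X)}

/-! ### The sign-free part: `toClass (hat G) = ∏ toClass (stellarPiece j)` -/

/-- The shrinking factor `t₀ = γ/4`. [folklore] -/
def stellarShrink (k : ℕ) : ℝ := heightGap k / 4

/-- `0 < t₀`. [folklore] -/
theorem stellarShrink_pos (k : ℕ) : 0 < stellarShrink k := by
  unfold stellarShrink; linarith [heightGap_pos k]

/-- `t₀ ≤ 1`. [folklore] -/
theorem stellarShrink_le_one (k : ℕ) : stellarShrink k ≤ 1 := by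
  unfold stellarShrink heightGap epsUnit
  have hk0 : (0 : ℝ) ≤ k := Nat.cast_nonneg k
  have h1 : (1 : ℝ) ≤ 4 * ((k : ℝ) + 1) ^ 2 := by nlinarith
  have h2 : (4 * ((k : ℝ) + 1) ^ 2)⁻¹ ≤ 1 := inv_le_one_of_one_le₀ h1
  have h3 : 0 ≤ (4 * ((k : ℝ) + 1) ^ 2)⁻¹ := by positivity
  have h4 : (4 * ((k : ℝ) + 1) ^ 2)⁻¹ / ((k : ℝ) + 1) ≤ (4 * ((k : ℝ) + 1) ^ 2)⁻¹ :=
    div_le_self h3 (by linarith)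
  linarith

/-- **On the shrunk support of the piece `j`, the height is within `t₀` of the height of the
centre `j`.** [folklore] -/
theorem abs_sub_le_of_mem_shrunkSet [NeZero k] {j : Fin (k + 1)} {y : Fin k → ℝ}
    (hy : y ∈ shrunkSet (fun j : Fin (k + 1) => stellarCell (k := k) j) stellarCenter j (stellarShrink k)) :
    |y 0 - stellarCenter j 0| ≤ stellarShrink k := by
  set t := stellarShrink k with ht
  have ht0 := stellarShrink_pos k
  set z := stellarCenter j + t⁻¹ • (y - stellarCenter j) with hz
  have hzmem : z ∈ cornerSimplex k := hy.1
  have hyz : y 0 - stellarCenter j 0 = t * (z 0 - stellarCenter j 0) := by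
    simp only [hz, Pi.add_apply, Pi.smul_apply, Pi.sub_apply, smul_eq_mul]
    rw [add_sub_cancel_left, ← mul_assoc, mul_inv_cancel₀ ht0.ne', one_mul]
  have hz0 : 0 ≤ z 0 ∧ z 0 ≤ 1 := ⟨hzmem.1 0,
    (Finset.single_le_sum (fun i _ => hzmem.1 i) (Finset.mem_univ 0)).trans hzmem.2⟩
  have hc0 : 0 ≤ stellarCenter j (0 : Fin k) ∧ stellarCenter j (0 : Fin k) ≤ 1 :=
    ⟨(stellarCenter_mem j).1 0,
      (Finset.single_le_sum (fun i _ => (stellarCenter_mem j).1 i) (Finset.mem_univ 0)).trans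
        (stellarCenter_mem j).2⟩
  rw [hyz, abs_mul, abs_of_pos ht0]
  have : |z 0 - stellarCenter j 0| ≤ 1 := by rw [abs_le]; constructor <;> linarith [hz0.1, hz0.2, hc0.1, hc0.2]
  nlinarith

/-- The glued sphere does not depend on how the pieces are indexed. [folklore] -/
theorem glue_reindex {ι : Type*} [Finite ι] (ψ : ι → CSphere k X x₀) (K : ι → Set (Fin k → ℝ))
    {hK hagree hoff} (e : ι ≃ ι) {hK' hagree' hoff'} :
    glue (fun i => ψ (e i)) (fun i => K (e i)) hK' hagree' hoff' = glue ψ K hK hagree hoff := by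
  refine ext fun y => ?_
  by_cases h : ∃ i, y ∈ K i
  · obtain ⟨i, hi⟩ := h
    have hi' : y ∈ (fun i => K (e i)) (e.symm i) := by simpa using hi
    rw [glue_apply_of_mem hi, glue_apply_of_mem (i := e.symm i) hi']
    simp
  · rw [glue_apply_of_forall_not_mem (fun i hi => h ⟨i, hi⟩),
      glue_apply_of_forall_not_mem (K := fun i => K (e i)) (fun i hi => h ⟨e i, hi⟩)]

/-- **The class of the hat of a stellar sphere is the product of the classes of its stellar
pieces** (`k ≥ 2`). [folklore] -/
theorem toClass_hat_eq_prod_stellarPiece [NeZero k] [Nontrivial (Fin k)] (hG : IsBased x₀ G)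
    (hg : ∀ j, IsBased x₀ (g j)) (hGg : IsStellar G g) :
    (hat G hG).toClass = ∏ j, (stellarPiece G hG g hg hGg j).toClass := by
  set ψ : Fin (k + 1) → CSphere k X x₀ := fun j => stellarPiece G hG g hg hGg j with hψ
  set Z : Fin (k + 1) → Set (Fin k → ℝ) := fun j => stellarCell j with hZ
  have hoff : ∀ j y, y ∉ interior (Z j) → ψ j y = x₀ := fun j y hy =>
    stellarPiece_eq_of_not_mem_interior hG hg hGg j y hy
  have hZc : ∀ j, IsClosed (Z j) := fun j => isClosed_stellarCell j
  have hZconv : ∀ j, Convex ℝ (Z j) := fun j => convex_stellarCell j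
  have hp : ∀ j, stellarCenter j ∈ interior (Z j) := fun j => stellarCenter_mem_interior j
  have hdisj : Pairwise fun i j => Disjoint (interior (Z i)) (interior (Z j)) := disjoint_interior_stellarCell
  set t := stellarShrink k with ht
  have ht0 : 0 < t := stellarShrink_pos k
  have ht1 : t ≤ 1 := stellarShrink_le_one k
  -- at factor `1` the glued sphere is `hat G`
  have hone : shrinkAt ψ Z stellarCenter hZc hZconv hp hdisj hoff 1 one_pos le_rfl = hat G hG := by
    refine ext fun y => ?_
    rw [shrinkAt_one_apply]
    by_cases hy : y ∈ cornerSimplex k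
    · obtain ⟨j, hj⟩ := exists_mem_stellarCell hy
      rw [glueFun_eq_of_mem (agree_of_disjoint_interior hZconv hp hdisj hoff) (i := j) hj]
      show stellarPiece G hG g hg hGg j y = hat G hG y
      rw [stellarPiece_apply, if_pos hj]
    · rw [glueFun_eq_of_forall_not_mem (fun j hj => hy hj.1), hat_apply_of_not_mem G hG hy]
  rw [← hone, (homotopic_shrinkAt (ψ := ψ) (Z := Z) (p := stellarCenter) (hZc := hZc)
    (hZconv := hZconv) (hp := hp) (hdisj := hdisj) (hoff := hoff) ht0 ht1).toClass_eq]
  -- at factor `t` the glued sphere is a glue of separated pieces; reindex by height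
  let e := heightOrder k
  have hreindex : shrinkAt ψ Z stellarCenter hZc hZconv hp hdisj hoff t ht0 ht1 =
      glue (fun i => homothety (ψ (e i)) (stellarCenter (e i)) t ht0)
        (fun i => shrunkSet Z stellarCenter (e i) t)
        (fun i => isClosed_shrunkSet hZc _ t)
        (fun i i' y hi hi' => shrink_agree hZconv hp hdisj hoff ht0 ht1 _ _ y hi hi')
        (fun i y hy => shrink_off hoff ht0 _ y hy) :=
    (glue_reindex (fun j => homothety (ψ j) (stellarCenter j) t ht0)
      (fun j => shrunkSet Z stellarCenter j t) e).symm
  rw [hreindex, toClass_glue_eq_prod _ _ _ _ _ (stellarWall k) stellarWall_mono]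
  · -- the product of the classes of the shrunk pieces, reindexed
    rw [← Equiv.prod_comp e (fun j => (stellarPiece G hG g hg hGg j).toClass)]
    refine Finset.prod_congr rfl fun i _ => ?_
    exact toClass_homothety (ψ (e i)) (stellarCenter (e i)) t ht0
  · -- each shrunk support lies strictly inside its slab
    intro i y hy
    have habs := abs_sub_le_of_mem_shrunkSet (j := e i) hy
    rw [abs_le] at habs
    have hγ := heightGap_pos k
    have hts : stellarShrink k = heightGap k / 4 := rfl
    have hH : stellarCenter (e i) (0 : Fin k) = sortedHeight k i := rfl
    rw [hH] at habs
    simp only [stellarWall]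
    constructor
    · rw [Fin.snoc_castSucc]; linarith [habs.1, hts, hγ]
    · rcases eq_or_ne i (Fin.last k) with rfl | hi
      · rw [show (Fin.last k).succ = Fin.last (k + 1) from Fin.succ_last k, Fin.snoc_last]
        linarith [habs.2, hts, hγ]
      · obtain ⟨i', rfl⟩ : ∃ i' : Fin k, i = i'.castSucc := ⟨i.castPred hi, (Fin.castSucc_castPred i hi).symm⟩
        rw [show i'.castSucc.succ = i'.succ.castSucc from rfl, Fin.snoc_castSucc]
        linarith [habs.2, heightGap_le_sub i', hts, hγ]

/-- **The stellar homotopy addition theorem.** If the based simplicial sphere `G : Δᵏ → X` is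
stellar with faces `g₀, …, g_k`, then `toClass (hat G) = ∏ⱼ toClass (hat gⱼ) ^ (-1)^j` in
`π_ k X x₀` (`k ≥ 2`). [folklore] -/
theorem toClass_hat_stellar [NeZero k] [Nontrivial (Fin k)] (hG : IsBased x₀ G)
    (hg : ∀ j, IsBased x₀ (g j)) (hGg : IsStellar G g) :
    (hat G hG).toClass = ∏ j, (hat (g j) (hg j)).toClass ^ ((-1 : ℤ) ^ (j : ℕ)) := by
  rw [toClass_hat_eq_prod_stellarPiece hG hg hGg]
  exact Finset.prod_congr rfl fun j _ => toClass_stellarPiece hG hg hGg j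

end CSphere

end Literature.AlgebraicTopology.Homotopy

end
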